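import Summits.QuantumFields.BalabanUV.Beta.GAN24.TaylorLamLegEL
import Literature.MathematicalPhysics.QuantumFieldTheory.Balaban1983to89.Beta.BalabanCompositeJets
import Literature.MathematicalPhysics.QuantumFieldTheory.Balaban1983to89.Beta.DecLiftAdjoint

/-!
# `BalabanUV.Beta.GAN24.TaylorLamBracket` — binder row G-an2-4 / (CONV-C), S-slot road «S3-Taylor», SHAPE rows Λt∕Λ∕Λ0 (and RATE rows dLt∕dL): generic leaf
# «Λ-BRACKET*» (row owner b2b-balaban-gan24-p1-g4 RULINGS-8∕-9, CLAIMS l.4800∕l.4834; holder b2b-balaban-gan24-formalise-leaf-10, gen 12) — THE COMPLEMENT of the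
# Λ-vertex identity of record (leaf-18-g12's `GAN24/TaylorLamVertexPairing`: `vertexPair_eq`, the collapsed form for `N = N′·R`): (i) THE Λ-ROW LEG ITSELF IN
# CLOSED FORM BEFORE PAIRING (gauge term ≡ 0), its coarse mass UNIFORM in the fine bond; (ii) the bracket against an ARBITRARY summable fine 1-form;
# (iii) THE DOMINATED EXCHANGE of the fine vertex sum with the coarse superposition `cwsum` of `SLam`, and the Λ vertex insertion of `lagrInc` at the top level.

NOT IN PRINT; OUR PROOF ATTEMPT (unit b2b-balaban-gan24-formalise-leaf-10, gen 12).  HONEST FRAMING (cell contract, verbatim): «discharging `BetaPertH` makes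
Bałaban's UV stability UNCONDITIONAL — a real constructive-QFT result; it is NOT the continuum limit and NOT the Clay problem.»  HONEST DEPENDENCY (verbatim):
«continuum YM on T⁴ ⇐ BetaPertH ∧ nine spine estimates (0/9 proved); BetaPertH ⇐ (D1) ∧ (D4) ∧ CAP+tail; G-an2-4 gates asym, D1 and NE2/3/4.»  [folklore]
lattice bookkeeping and absolutely convergent sums over an2∕an5 DEFINITIONS and THEOREMS BY NAME (`KernelSpecInstance.wH`∕`wΦ`∕`wM`∕`wH_Q`∕`decay_wH`∕`decay_wΦ`,
an5's `ResolventComposition.wM_eq_zero` (THE GAUGE MULTIPLIER OF THE MINIMISER VANISHES, p188919 §1), `KKTFluctuationEnergy.lip1_contourSumAdj` (adjointness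
`⟨A, 𝒬ᵀφ⟩ = ⟨𝒬A, φ⟩` on `ℤ^{d+1}`), `BalabanStepJets.lamCoeffOf`, `InterLevelTransport.SLam`∕`cwsum_apply`∕`avgLift`, `BalabanCompositeJets.lagrInc`,
`DecLiftAdjoint.abs_avgLift_le`, `AveragingHessianKernels.biLoc_hessFF`, leaf-10-g11's `TaylorLamLegEL.lamCoeffOf_KInv_eq_EL`; Mathlib's `summable_prod_of_nonneg`,
`Summable.tsum_comm`); generic `d`, generic blockings `N, N′ ≥ 1` (no divisibility); 0 cite, 0 def, 0 `def … : Prop`, no estimate of (N1)∕(N3)∕the K-slot;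
NOTHING of (hS, hSall)∕«E3Shape» discharged.  NOT summit progress.

WHY (owner RULINGS-8∕-9).  In every Λ sandwich (`E3UnitSplitLevels.e3FF_unit_split_of`, `T = lagrInc d Lc M N′ κ″ u = SLam N′ (lamCoeffOf (KInv N′) N′)
(avgLift M ∘ hessFF Lc) κ″ u`) the multiplier-response leg `lamCoeffOf (KInv N′) N′ μ yy κ″ u` sits INSIDE the coarse superposition `cwsum N′` (a `yy`-tsum) INSIDE the fine
vertex sum (a `u`-tsum against the level-`N` minimiser column).  By leaf-10-g11's EL dictionary the leg is `−𝒬ᵀ_{N′} wΦ_{N′} − dδd wM_{N′}`; the located residual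
«(N1-gauge)» is VOID because an5's tree theorem `ResolventComposition.wM_eq_zero` gives `wM_{N′} ≡ 0` (RULINGS-9: struck by name).  §1 records the leg in closed form
and its COARSE MASS `Σ'_yy |leg| ≤ N′·Σ'|wΦ_{N′}|` uniformly in the fine bond — the domination that makes the `u`∕`yy` exchange legitimate; §2 is the `𝒬∕𝒬ᵀ` adjointness
form of the bracket for any summable vertex leg; §3 performs the exchange once, generically (`vertex_SLam_eq`), and at the top level `N′ = N` (row Λt), where
`𝒬_N ℋ_N = δ` (`wH_Q`) collapses the pairing, states the vertex insertion of `lagrInc` as a coarse superposition of the level-`N` multiplier kernel `wΦ_N` against an1's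
lifted constraint Hessians (`vertex_lagrInc_top`).  The collapsed identity for the pushed rows (`N = N′·R`, read through `𝒬ᵀ_R` of the TOP kernel) is leaf-18-g12's
`TaylorLamVertexPairing.vertexPair_eq` and is NOT restated here.

WHAT IS PROVED (0 sorry; 26 theorems, 0 def):
§1 `opM_wM_apply` (`dδd wM_N ≡ 0`), **`lamCoeffOf_KInv_eq_neg_contourSumAdj`** `lamCoeffOf (KInv N) N μ y κ′ u = −(𝒬ᵀ_N wΦ_N(·,μ,·))_{κ′}(u − N•y)`,
   `…_shift` (`= −(𝒬ᵀ_N wΦ_N(·, μ, · − y))_{κ′}(u)`), `lamCoeffOf_KInv_eq_neg_sum_wPhi` (`= −Σ_{s<N} wΦ_N κ′ μ (quo N (u − s•e_{κ′}) − y)`),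
   `abs_lamCoeffOf_KInv_le_mul` (`≤ N·B` from `|wΦ_N κ′ μ ·| ≤ B`), `exists_abs_lamCoeffOf_KInv_le` (a bound uniform in all arguments, per `N`).
§2 **`bracket_eq_neg_pairing`**: for every fine 1-form `A` summable in each direction,
   `Σ'_u Σ_{κ″} A κ″ u · lamCoeffOf (KInv N′) N′ μ yy κ″ u = −Σ'_b Σ_κ wΦ_{N′} κ μ (b − yy) · (𝒬_{N′} A)_κ(b)`; `summable_mul_lamCoeffOf`;
   `bracket_eq_neg_pairing'` (the nesting `Σ_{κ″} Σ'_u` of `E3UnitSplit.e3OfS_ff`); `summable_wH_col`; `bracket_wH` (A = the translated level-`N` minimiser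
   column, ANY `N, N′`); `contourSum_wH_col` + `pairing_top` (`N′ = N`: `𝒬_N ℋ_N^{(κ′,u′)} = δ`, so the pairing is `wΦ_N κ′ μ (u′ − yy)` — leaf-18's `vertexPair_top`
   reads the same number as `wΦ_N μ κ′ (yy − u′)`; both are kernel facts).
§3 `summable_uncurry_of_fibre_bound` (Fubini brick), `summable_wPhi_sub`, `tsum_abs_wPhi_sub`, `summable_lamCoeffOf_yy`, **`tsum_abs_lamCoeffOf_le`**
   (`Σ'_yy |lamCoeffOf (KInv N′) N′ μ yy κ″ u| ≤ N′·Σ'_t |wΦ_{N′} κ″ μ t|`, uniform in `u`), `summable_uncurry_leg`, `tsum_mul_tsum_leg_comm` (the dominated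
   exchange), `summable_bracket_mul`, `summable_mul_tsum_leg`, **`vertex_SLam_eq`** (the Λ vertex insertion of `SLam N′ (lamCoeffOf (KInv N′) N′) Q2` against
   a summable `A`, for entrywise-bounded `Q2`, is `Σ_μ Σ'_yy (Σ'_b Σ_κ wΦ_{N′} κ μ (b − yy)·(𝒬_{N′}A)_κ(b)) · Q2 μ yy w y a b`), **`vertex_SLam_top`** (`N′ = N`:
   `= Σ_μ Σ'_yy wΦ_N κ′ μ (u′ − yy) · Q2 μ yy w y a b`), `abs_avgLift_hessFF_le` (`≤ 2ℓ(Lc)²`) and **`vertex_lagrInc_top`**: `Σ_{κ″} Σ'_u wH_N κ″ κ′ (u − N•u′) ·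
   lagrInc d Lc M N κ″ u w y a b = Σ_μ Σ'_yy wΦ_N κ′ μ (u′ − yy) · avgLift M (hessFF Lc μ yy) w y a b` (every `M`, `N`, `Lc ≥ 1`; top Λ row: `M = Lc^ℓ`, `N = Lc^{ℓ+1}`).
-/

noncomputable section

open Finset
open scoped BigOperators
open Literature.MathematicalPhysics.QuantumFieldTheory
open Literature.MathematicalPhysics.QuantumFieldTheory.LatticeForm (quo)
open Literature.MathematicalPhysics.QuantumFieldTheory.Balaban1983to89
open Literature.MathematicalPhysics.QuantumFieldTheory.Balaban1983to89.Beta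
open AffineAveraging (Site Form0 Form1 unitVec dz codiff₁ contourSum)
open AffineReproduction (contourSumAdj)
open OneStepResolventKernel (Fib KInv)
open KernelSpecInstance (wH wΦ wM wH_Q decay_wH decay_wΦ contourSum_shift contourSumAdj_shift)
open ResolventComposition (wM_eq_zero)
open KKTFluctuationEnergy (lip1 lip1_contourSumAdj summable_mul_of_bdd summable_mul_of_bdd' summable_shift_sub)
open KKTFluctuationUnique (abs_le_of_decay510)
open DecimatedMomentLimit (summable_of_decay510)
open BalabanStepJets (lamCoeffOf)
open InterLevelTransport (SLam cwsum cwsum_apply avgLift)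
open BalabanCompositeJets (lagrInc summable_contourSum)
open AveragingHessianKernels (hessFF biLoc_hessFF ell)
open DecLiftAdjoint (abs_avgLift_le)
open Summit.QuantumFields.BalabanUV.Beta.GAN24.TaylorLamLegEL (lamCoeffOf_KInv_eq_EL abs_contourSumAdj_le)

namespace Summit.QuantumFields.BalabanUV.Beta.GAN24.TaylorLamBracket

variable {d : ℕ}

/-! ## §1 The gauge term of the Λ-row leg vanishes identically; the leg in closed form -/

section Leg

variable {N : ℕ} [NeZero N]

/-- [folklore] **THE GAUGE TERM IS IDENTICALLY ZERO**: `(dδd wM_N^{(μ)})_κ(x) = 0`, because the gauge multiplier of the minimiser vanishes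
(an5's `ResolventComposition.wM_eq_zero`). The located residual «(N1-gauge)» of RULINGS-7 is therefore not an input. -/
theorem opM_wM_apply (μ κ : Fin (d + 1)) (x : Site (d + 1)) : dz (codiff₁ (dz (wM (N := N) μ))) κ x = 0 := by
  rw [wM_eq_zero]
  simp [dz, codiff₁]

/-- [folklore] **THE Λ-ROW LEG IN CLOSED FORM**: `lamCoeffOf (KInv N) N μ y κ′ u = −(𝒬ᵀ_N wΦ_N(·, μ, ·))_{κ′}(u − N•y)` — leaf-10-g11's Euler–Lagrange
dictionary `lamCoeffOf_KInv_eq_EL` with the gauge term struck by `opM_wM_apply`. -/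
theorem lamCoeffOf_KInv_eq_neg_contourSumAdj (μ : Fin (d + 1)) (y : Site (d + 1)) (κ' : Fin (d + 1)) (u : Site (d + 1)) :
    lamCoeffOf (KInv (N := N) (d := d)) N μ y κ' u =
      -contourSumAdj N (fun κ y' => wΦ (N := N) κ μ y') κ' (u - (N : ℤ) • y) := by
  rw [lamCoeffOf_KInv_eq_EL, opM_wM_apply, add_zero]

/-- [folklore] The same with the coarse translation moved onto the multiplier kernel: `= −(𝒬ᵀ_N wΦ_N(·, μ, · − y))_{κ′}(u)`. -/
theorem lamCoeffOf_KInv_eq_neg_contourSumAdj_shift (μ : Fin (d + 1)) (y : Site (d + 1)) (κ' : Fin (d + 1)) (u : Site (d + 1)) :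
    lamCoeffOf (KInv (N := N) (d := d)) N μ y κ' u =
      -contourSumAdj N (fun κ q => wΦ (N := N) κ μ (q - y)) κ' u := by
  rw [lamCoeffOf_KInv_eq_neg_contourSumAdj, ← contourSumAdj_shift (fun κ q => wΦ (N := N) κ μ q) y κ' u]

/-- [folklore] The leg as an explicit finite sum of multiplier-kernel entries along the contour through `(κ′, u)`:
`lamCoeffOf (KInv N) N μ y κ′ u = −Σ_{s<N} wΦ_N κ′ μ (quo N (u − s•e_{κ′}) − y)`. -/
theorem lamCoeffOf_KInv_eq_neg_sum_wPhi (μ : Fin (d + 1)) (y : Site (d + 1)) (κ' : Fin (d + 1)) (u : Site (d + 1)) :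
    lamCoeffOf (KInv (N := N) (d := d)) N μ y κ' u =
      -∑ s ∈ Finset.range N, wΦ (N := N) κ' μ (quo N (u - (s : ℤ) • unitVec κ') - y) := by
  rw [lamCoeffOf_KInv_eq_neg_contourSumAdj_shift]
  rfl

/-- [folklore] **SIZE OF THE LEG FROM THE MULTIPLIER KERNEL ALONE**: `|wΦ_N κ′ μ q| ≤ B` for all `q` gives `|lamCoeffOf (KInv N) N μ y κ′ u| ≤ N·B`
(`N` incidences per fine bond; no gauge term, no cancellation). -/
theorem abs_lamCoeffOf_KInv_le_mul {B : ℝ} (μ κ' : Fin (d + 1)) (hB : ∀ q, |wΦ (N := N) κ' μ q| ≤ B) (y : Site (d + 1)) (u : Site (d + 1)) :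
    |lamCoeffOf (KInv (N := N) (d := d)) N μ y κ' u| ≤ N * B := by
  rw [lamCoeffOf_KInv_eq_neg_sum_wPhi, abs_neg]
  refine (Finset.abs_sum_le_sum_abs _ _).trans ((Finset.sum_le_sum fun s _ => hB _).trans ?_)
  simp

/-- [folklore] A bound of the leg uniform in all its arguments (at fixed `N`; the constant is that of `decay_wΦ (N := N)` times `N`). -/
theorem exists_abs_lamCoeffOf_KInv_le :
    ∃ C : ℝ, 0 ≤ C ∧ ∀ μ y κ' u, |lamCoeffOf (KInv (N := N) (d := d)) N μ y κ' u| ≤ C := by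
  obtain ⟨δ, C, hδ, h⟩ := decay_wΦ (N := N) (d := d)
  have hC : 0 ≤ C := (abs_nonneg _).trans (abs_le_of_decay510 hδ (h 0 0) 0)
  refine ⟨N * C, by positivity, fun μ y κ' u => ?_⟩
  exact abs_lamCoeffOf_KInv_le_mul μ κ' (fun q => abs_le_of_decay510 hδ (h κ' μ) q) y u

end Leg

/-! ## §2 The Λ bracket in closed K-slot form -/

section Bracket

variable {N N' : ℕ} [NeZero N] [NeZero N']

/-- [folklore] **THE Λ BRACKET IN CLOSED K-SLOT FORM** (owner RULINGS-8 (a), generic): for every fine 1-form `A` summable in each direction and every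
blocking `N′ ≥ 1`, `Σ'_u Σ_{κ″} A κ″ u · lamCoeffOf (KInv N′) N′ μ yy κ″ u = −Σ'_b Σ_κ wΦ_{N′} κ μ (b − yy) · (𝒬_{N′} A)_κ(b)` — the `𝒬∕𝒬ᵀ` adjointness
`KKTFluctuationEnergy.lip1_contourSumAdj` applied to the closed form of §1.  No divisibility, no gauge input. -/
theorem bracket_eq_neg_pairing (A : Form1 (d + 1) ℝ) (hA : ∀ κ, Summable (A κ)) (μ : Fin (d + 1)) (yy : Site (d + 1)) :
    ∑' u, ∑ κ'', A κ'' u * lamCoeffOf (KInv (N := N') (d := d)) N' μ yy κ'' u =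
      -∑' b, ∑ κ, wΦ (N := N') κ μ (b - yy) * contourSum N' A κ b := by
  obtain ⟨δ, C, hδ, h⟩ := decay_wΦ (N := N') (d := d)
  have hφ : ∀ κ q, |(fun κ q => wΦ (N := N') κ μ (q - yy)) κ q| ≤ C := fun κ q => abs_le_of_decay510 hδ (h κ μ) _
  have hlip := lip1_contourSumAdj (N := N') (A := A) hA hφ
  unfold lip1 at hlip
  rw [← hlip, ← tsum_neg]
  refine tsum_congr fun u => ?_
  rw [← Finset.sum_neg_distrib]
  refine Finset.sum_congr rfl fun κ'' _ => ?_
  rw [lamCoeffOf_KInv_eq_neg_contourSumAdj_shift, mul_neg]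

/-- [folklore] The bracket's inner family is summable in `u` for each direction (summable × bounded). -/
theorem summable_mul_lamCoeffOf (A : Form1 (d + 1) ℝ) (hA : ∀ κ, Summable (A κ)) (μ : Fin (d + 1)) (yy : Site (d + 1))
    (κ'' : Fin (d + 1)) : Summable fun u => A κ'' u * lamCoeffOf (KInv (N := N') (d := d)) N' μ yy κ'' u := by
  obtain ⟨C, _, hC⟩ := exists_abs_lamCoeffOf_KInv_le (N := N') (d := d)
  exact summable_mul_of_bdd' (hA κ'') fun u => hC μ yy κ'' u

/-- [folklore] **THE Λ BRACKET, OWNER'S NESTING** (`Σ_{κ″} Σ'_u`, as it sits inside `E3UnitSplit.e3OfS_ff`). -/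
theorem bracket_eq_neg_pairing' (A : Form1 (d + 1) ℝ) (hA : ∀ κ, Summable (A κ)) (μ : Fin (d + 1)) (yy : Site (d + 1)) :
    ∑ κ'', ∑' u, A κ'' u * lamCoeffOf (KInv (N := N') (d := d)) N' μ yy κ'' u =
      -∑' b, ∑ κ, wΦ (N := N') κ μ (b - yy) * contourSum N' A κ b := by
  rw [← bracket_eq_neg_pairing A hA μ yy, Summable.tsum_finsetSum fun κ'' _ => summable_mul_lamCoeffOf A hA μ yy κ'']

/-- [folklore] The translated level-`N` minimiser column `u ↦ wH_N κ″ κ′ (u − N•u′)` is summable in the FINE variable `u` (decay at fixed `N`). -/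
theorem summable_wH_col (κ'' κ' : Fin (d + 1)) (u' : Site (d + 1)) :
    Summable fun u : Site (d + 1) => wH (N := N) κ'' κ' (u - (N : ℤ) • u') := by
  obtain ⟨δ, C, hδ, h⟩ := decay_wH (N := N) (d := d)
  exact summable_shift_sub (summable_of_decay510 hδ (h κ'' κ')) _

/-- [folklore] **THE Λ BRACKET OF THE SANDWICH** (any pair of blockings `N, N′ ≥ 1`): with the translated level-`N` minimiser column as the
vertex leg, `β(μ,yy) = Σ_{κ″} Σ'_u wH_N κ″ κ′ (u − N•u′) · lamCoeffOf (KInv N′) N′ μ yy κ″ u = −Σ'_b Σ_κ wΦ_{N′} κ μ (b − yy) · (𝒬_{N′} ℋ_N^{(κ′,u′)})_κ(b)`. -/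
theorem bracket_wH (κ' : Fin (d + 1)) (u' : Site (d + 1)) (μ : Fin (d + 1)) (yy : Site (d + 1)) :
    ∑ κ'', ∑' u, wH (N := N) κ'' κ' (u - (N : ℤ) • u') * lamCoeffOf (KInv (N := N') (d := d)) N' μ yy κ'' u =
      -∑' b, ∑ κ, wΦ (N := N') κ μ (b - yy) *
        contourSum N' (fun κ'' u => wH (N := N) κ'' κ' (u - (N : ℤ) • u')) κ b := by
  have h := bracket_eq_neg_pairing' (N' := N') (fun κ'' u => wH (N := N) κ'' κ' (u - (N : ℤ) • u'))
    (fun κ'' => summable_wH_col κ'' κ' u') μ yy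
  simpa only using h

/-- [folklore] The `N`-contour sums of the translated level-`N` minimiser column are the indicator of the source bond `(κ′, u′)`
(`KernelSpecInstance.wH_Q`, the reproduction identity `𝒬_N ℋ_N = δ`). -/
theorem contourSum_wH_col (κ' : Fin (d + 1)) (u' : Site (d + 1)) (κ : Fin (d + 1)) (b : Site (d + 1)) :
    contourSum N (fun κ'' u => wH (N := N) κ'' κ' (u - (N : ℤ) • u')) κ b = if b = u' ∧ κ = κ' then 1 else 0 := by
  rw [contourSum_shift (N := N) (fun κ'' u => wH (N := N) κ'' κ' u) u' κ b, wH_Q]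
  simp only [sub_eq_zero]

/-- [folklore] **TOP-LEVEL PAIRING**: `Σ'_b Σ_κ wΦ_N κ μ (b − yy) · (𝒬_N ℋ_N^{(κ′,u′)})_κ(b) = wΦ_N κ′ μ (u′ − yy)`. -/
theorem pairing_top (κ' : Fin (d + 1)) (u' : Site (d + 1)) (μ : Fin (d + 1)) (yy : Site (d + 1)) :
    ∑' b, ∑ κ, wΦ (N := N) κ μ (b - yy) * contourSum N (fun κ'' u => wH (N := N) κ'' κ' (u - (N : ℤ) • u')) κ b =
      wΦ (N := N) κ' μ (u' - yy) := by
  simp only [contourSum_wH_col, mul_ite, mul_one, mul_zero]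
  have hsum : ∀ b : Site (d + 1), (∑ κ : Fin (d + 1), if b = u' ∧ κ = κ' then wΦ (N := N) κ μ (b - yy) else 0)
      = if b = u' then wΦ (N := N) κ' μ (u' - yy) else 0 := fun b => by
    by_cases hb : b = u' <;> simp [hb]
  simp only [hsum]
  rw [tsum_ite_eq]

end Bracket

/-! ## §3 The Λ vertex insertion of `SLam` ∕ `lagrInc`: the bracket through the coarse superposition `cwsum` -/

section Vertex

variable {N N' : ℕ} [NeZero N] [NeZero N']

/-- [folklore] A FUBINI BRICK on `ℤ^{d+1} × ℤ^{d+1}`: if `a` is summable, every fibre `yy ↦ f u yy` is absolutely summable and the fibre sums are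
at most `|a u|·K`, then `f` is summable on the product (so `Summable.tsum_comm` applies). -/
theorem summable_uncurry_of_fibre_bound {f : Site (d + 1) → Site (d + 1) → ℝ} {a : Site (d + 1) → ℝ} {K : ℝ}
    (ha : Summable a) (hf : ∀ u, Summable fun yy => |f u yy|) (hK : ∀ u, ∑' yy, |f u yy| ≤ |a u| * K) :
    Summable (Function.uncurry f) := by
  have hg : Summable (Function.uncurry fun u yy => |f u yy|) := by
    refine (summable_prod_of_nonneg fun p => abs_nonneg _).2 ⟨fun u => hf u, ?_⟩
    exact Summable.of_nonneg_of_le (fun u => tsum_nonneg fun yy => abs_nonneg _) hK (ha.abs.mul_right K)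
  exact Summable.of_norm_bounded hg fun p => le_of_eq (Real.norm_eq_abs _)

/-- [folklore] A coarse translate of the multiplier kernel is summable in the translation variable. -/
theorem summable_wPhi_sub (κ μ : Fin (d + 1)) (q : Site (d + 1)) :
    Summable fun yy : Site (d + 1) => wΦ (N := N') κ μ (q - yy) := by
  obtain ⟨δ, C, hδ, h⟩ := decay_wΦ (N := N') (d := d)
  exact (summable_of_decay510 hδ (h κ μ)).comp_injective fun _ _ e => sub_right_injective e

/-- [folklore] … and its absolute sum does not depend on the translation. -/
theorem tsum_abs_wPhi_sub (κ μ : Fin (d + 1)) (q : Site (d + 1)) :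
    ∑' yy : Site (d + 1), |wΦ (N := N') κ μ (q - yy)| = ∑' t, |wΦ (N := N') κ μ t| := by
  simpa only [Equiv.subLeft_apply] using (Equiv.subLeft q).tsum_eq fun t => |wΦ (N := N') κ μ t|

/-- [folklore] The Λ-row leg is summable in the COARSE bond position `yy` (a finite sum of coarse translates of `wΦ`, §1). -/
theorem summable_lamCoeffOf_yy (μ κ'' : Fin (d + 1)) (u : Site (d + 1)) :
    Summable fun yy : Site (d + 1) => lamCoeffOf (KInv (N := N') (d := d)) N' μ yy κ'' u := by
  have h : (fun yy : Site (d + 1) => lamCoeffOf (KInv (N := N') (d := d)) N' μ yy κ'' u) =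
      fun yy => -∑ s ∈ Finset.range N', wΦ (N := N') κ'' μ (quo N' (u - (s : ℤ) • unitVec κ'') - yy) := by
    funext yy; exact lamCoeffOf_KInv_eq_neg_sum_wPhi μ yy κ'' u
  rw [h]
  exact (summable_sum fun s _ => summable_wPhi_sub κ'' μ _).neg

/-- [folklore] **THE COARSE MASS OF THE LEG IS UNIFORM IN THE FINE BOND**: `Σ'_yy |lamCoeffOf (KInv N′) N′ μ yy κ″ u| ≤ N′ · Σ'_t |wΦ_{N′} κ″ μ t|`. -/
theorem tsum_abs_lamCoeffOf_le (μ κ'' : Fin (d + 1)) (u : Site (d + 1)) :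
    ∑' yy : Site (d + 1), |lamCoeffOf (KInv (N := N') (d := d)) N' μ yy κ'' u| ≤ N' * ∑' t, |wΦ (N := N') κ'' μ t| := by
  have hpt : ∀ yy : Site (d + 1), |lamCoeffOf (KInv (N := N') (d := d)) N' μ yy κ'' u| ≤
      ∑ s ∈ Finset.range N', |wΦ (N := N') κ'' μ (quo N' (u - (s : ℤ) • unitVec κ'') - yy)| := by
    intro yy
    rw [lamCoeffOf_KInv_eq_neg_sum_wPhi, abs_neg]
    exact Finset.abs_sum_le_sum_abs _ _
  have hsum : Summable fun yy : Site (d + 1) =>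
      ∑ s ∈ Finset.range N', |wΦ (N := N') κ'' μ (quo N' (u - (s : ℤ) • unitVec κ'') - yy)| :=
    summable_sum fun s _ => (summable_wPhi_sub κ'' μ _).abs
  calc ∑' yy, |lamCoeffOf (KInv (N := N') (d := d)) N' μ yy κ'' u|
      ≤ ∑' yy, ∑ s ∈ Finset.range N', |wΦ (N := N') κ'' μ (quo N' (u - (s : ℤ) • unitVec κ'') - yy)| :=
        Summable.tsum_le_tsum hpt (summable_lamCoeffOf_yy μ κ'' u).abs hsum
    _ = ∑ s ∈ Finset.range N', ∑' yy, |wΦ (N := N') κ'' μ (quo N' (u - (s : ℤ) • unitVec κ'') - yy)| :=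
        Summable.tsum_finsetSum fun s _ => (summable_wPhi_sub κ'' μ _).abs
    _ = ∑ _s ∈ Finset.range N', ∑' t, |wΦ (N := N') κ'' μ t| :=
        Finset.sum_congr rfl fun s _ => tsum_abs_wPhi_sub κ'' μ _
    _ = N' * ∑' t, |wΦ (N := N') κ'' μ t| := by simp

/-- [folklore] Product summability of `(u, yy) ↦ a u · (lamCoeffOf (KInv N′) N′ μ yy κ″ u · Q yy)` for summable `a` and bounded `Q`. -/
theorem summable_uncurry_leg (a : Site (d + 1) → ℝ) (ha : Summable a) (μ κ'' : Fin (d + 1)) (Q : Site (d + 1) → ℝ) {B : ℝ}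
    (hQ : ∀ yy, |Q yy| ≤ B) :
    Summable (Function.uncurry fun u yy => a u * (lamCoeffOf (KInv (N := N') (d := d)) N' μ yy κ'' u * Q yy)) := by
  have hB : 0 ≤ B := (abs_nonneg _).trans (hQ 0)
  have hcQ : ∀ u, Summable fun yy => lamCoeffOf (KInv (N := N') (d := d)) N' μ yy κ'' u * Q yy := fun u =>
    summable_mul_of_bdd' (summable_lamCoeffOf_yy μ κ'' u) hQ
  refine summable_uncurry_of_fibre_bound (K := B * (N' * ∑' t, |wΦ (N := N') κ'' μ t|)) ha
    (fun u => ((hcQ u).mul_left (a u)).abs) (fun u => ?_)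
  have h1 : ∀ yy, |a u * (lamCoeffOf (KInv (N := N') (d := d)) N' μ yy κ'' u * Q yy)| ≤
      |a u| * (B * |lamCoeffOf (KInv (N := N') (d := d)) N' μ yy κ'' u|) := fun yy => by
    rw [abs_mul, abs_mul, mul_comm |lamCoeffOf _ _ _ _ _ _|]
    exact mul_le_mul_of_nonneg_left (mul_le_mul_of_nonneg_right (hQ yy) (abs_nonneg _)) (abs_nonneg _)
  have h2 : Summable fun yy => |a u| * (B * |lamCoeffOf (KInv (N := N') (d := d)) N' μ yy κ'' u|) :=
    (((summable_lamCoeffOf_yy μ κ'' u).abs.mul_left B).mul_left |a u|)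
  calc ∑' yy, |a u * (lamCoeffOf (KInv (N := N') (d := d)) N' μ yy κ'' u * Q yy)|
      ≤ ∑' yy, |a u| * (B * |lamCoeffOf (KInv (N := N') (d := d)) N' μ yy κ'' u|) :=
        Summable.tsum_le_tsum h1 ((hcQ u).mul_left (a u)).abs h2
    _ = |a u| * (B * ∑' yy, |lamCoeffOf (KInv (N := N') (d := d)) N' μ yy κ'' u|) := by
        rw [tsum_mul_left, tsum_mul_left]
    _ ≤ |a u| * (B * (N' * ∑' t, |wΦ (N := N') κ'' μ t|)) :=
        mul_le_mul_of_nonneg_left (mul_le_mul_of_nonneg_left (tsum_abs_lamCoeffOf_le μ κ'' u) hB) (abs_nonneg _)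

/-- [folklore] **THE DOMINATED EXCHANGE** of the fine vertex sum and the coarse superposition:
`Σ'_u a u · Σ'_yy c(μ,yy;κ″,u)·Q yy = Σ'_yy (Σ'_u a u · c(μ,yy;κ″,u)) · Q yy` (`c` = the Λ-row leg; `a` summable, `Q` bounded). -/
theorem tsum_mul_tsum_leg_comm (a : Site (d + 1) → ℝ) (ha : Summable a) (μ κ'' : Fin (d + 1)) (Q : Site (d + 1) → ℝ) {B : ℝ}
    (hQ : ∀ yy, |Q yy| ≤ B) :
    ∑' u, a u * ∑' yy, lamCoeffOf (KInv (N := N') (d := d)) N' μ yy κ'' u * Q yy =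
      ∑' yy, (∑' u, a u * lamCoeffOf (KInv (N := N') (d := d)) N' μ yy κ'' u) * Q yy := by
  have hprod := summable_uncurry_leg (N' := N') a ha μ κ'' Q hQ
  calc ∑' u, a u * ∑' yy, lamCoeffOf (KInv (N := N') (d := d)) N' μ yy κ'' u * Q yy
      = ∑' u, ∑' yy, a u * (lamCoeffOf (KInv (N := N') (d := d)) N' μ yy κ'' u * Q yy) :=
        tsum_congr fun u => tsum_mul_left.symm
    _ = ∑' yy, ∑' u, a u * (lamCoeffOf (KInv (N := N') (d := d)) N' μ yy κ'' u * Q yy) := hprod.tsum_comm.symm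
    _ = ∑' yy, (∑' u, a u * lamCoeffOf (KInv (N := N') (d := d)) N' μ yy κ'' u) * Q yy :=
        tsum_congr fun yy => by rw [← tsum_mul_right]; exact tsum_congr fun u => by ring

/-- [folklore] The `yy`-family after the exchange is summable. -/
theorem summable_bracket_mul (a : Site (d + 1) → ℝ) (ha : Summable a) (μ κ'' : Fin (d + 1)) (Q : Site (d + 1) → ℝ) {B : ℝ}
    (hQ : ∀ yy, |Q yy| ≤ B) :
    Summable fun yy => (∑' u, a u * lamCoeffOf (KInv (N := N') (d := d)) N' μ yy κ'' u) * Q yy := by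
  have h := (summable_uncurry_leg (N' := N') a ha μ κ'' Q hQ).prod_symm.prod
  refine h.congr fun yy => ?_
  show ∑' u, a u * (lamCoeffOf (KInv (N := N') (d := d)) N' μ yy κ'' u * Q yy) = _
  rw [← tsum_mul_right]
  exact tsum_congr fun u => by ring

/-- [folklore] The `u`-family before the exchange is summable (summable × bounded coarse sum). -/
theorem summable_mul_tsum_leg (a : Site (d + 1) → ℝ) (ha : Summable a) (μ κ'' : Fin (d + 1)) (Q : Site (d + 1) → ℝ) {B : ℝ}
    (hQ : ∀ yy, |Q yy| ≤ B) :
    Summable fun u => a u * ∑' yy, lamCoeffOf (KInv (N := N') (d := d)) N' μ yy κ'' u * Q yy := by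
  have hB : 0 ≤ B := (abs_nonneg _).trans (hQ 0)
  refine summable_mul_of_bdd' ha (M := B * (N' * ∑' t, |wΦ (N := N') κ'' μ t|)) fun u => ?_
  have h1 := BalabanCompositeJets.abs_tsum_mul_le (d := d) hQ (summable_lamCoeffOf_yy (N' := N') μ κ'' u)
  rw [show (∑' yy, lamCoeffOf (KInv (N := N') (d := d)) N' μ yy κ'' u * Q yy) =
      ∑' yy, Q yy * lamCoeffOf (KInv (N := N') (d := d)) N' μ yy κ'' u from tsum_congr fun yy => mul_comm _ _]
  exact h1.trans (mul_le_mul_of_nonneg_left (tsum_abs_lamCoeffOf_le μ κ'' u) hB)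

/-- [folklore] **THE Λ VERTEX INSERTION OF THE MULTIPLIER-CURVATURE STENCIL** (owner RULINGS-8 (a), steps «exchange `cwsum`∕`u`-tsum» + «Λ-BRACKET»):
for every fine 1-form `A` summable in each direction, every family `Q2` of entrywise-bounded kernels and every blocking `N′ ≥ 1`,
`Σ_{κ″} Σ'_u A κ″ u · (SLam N′ (lamCoeffOf (KInv N′) N′) Q2 κ″ u) w y a b = Σ_μ Σ'_yy (Σ'_b Σ_κ wΦ_{N′} κ μ (b − yy)·(𝒬_{N′} A)_κ(b)) · Q2 μ yy w y a b`. -/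
theorem vertex_SLam_eq (A : Form1 (d + 1) ℝ) (hA : ∀ κ, Summable (A κ))
    (Q2 : Fin (d + 1) → Site (d + 1) → ExpKernelCalculus.MKer (d + 1) (Fib d)) {B : ℝ}
    (hQ : ∀ μ yy w y a b, |Q2 μ yy w y a b| ≤ B) (w y : Site (d + 1)) (a b : Fib d) :
    ∑ κ'', ∑' u, A κ'' u * SLam N' (lamCoeffOf (KInv (N := N') (d := d)) N') Q2 κ'' u w y a b =
      ∑ μ, ∑' yy, (∑' bb, ∑ κ, wΦ (N := N') κ μ (bb - yy) * contourSum N' A κ bb) * Q2 μ yy w y a b := by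
  have hS : ∀ κ'' u, SLam N' (lamCoeffOf (KInv (N := N') (d := d)) N') Q2 κ'' u w y a b =
      -∑ μ, ∑' yy, lamCoeffOf (KInv (N := N') (d := d)) N' μ yy κ'' u * Q2 μ yy w y a b := by
    intro κ'' u
    show -(∑ μ, cwsum N' (fun yy => lamCoeffOf (KInv (N := N') (d := d)) N' μ yy κ'' u) (Q2 μ) w y a b) = _
    simp only [cwsum_apply]
  simp_rw [hS]
  have hT : ∀ κ'' μ, Summable fun u => A κ'' u *
      ∑' yy, lamCoeffOf (KInv (N := N') (d := d)) N' μ yy κ'' u * Q2 μ yy w y a b := fun κ'' μ =>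
    summable_mul_tsum_leg (A κ'') (hA κ'') μ κ'' (fun yy => Q2 μ yy w y a b) fun yy => hQ μ yy w y a b
  have hY : ∀ μ κ'', Summable fun yy => (∑' u, A κ'' u * lamCoeffOf (KInv (N := N') (d := d)) N' μ yy κ'' u) *
      Q2 μ yy w y a b := fun μ κ'' =>
    summable_bracket_mul (A κ'') (hA κ'') μ κ'' (fun yy => Q2 μ yy w y a b) fun yy => hQ μ yy w y a b
  calc ∑ κ'', ∑' u, A κ'' u * -∑ μ, ∑' yy, lamCoeffOf (KInv (N := N') (d := d)) N' μ yy κ'' u * Q2 μ yy w y a b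
      = ∑ κ'', ∑' u, ∑ μ, -(A κ'' u * ∑' yy, lamCoeffOf (KInv (N := N') (d := d)) N' μ yy κ'' u * Q2 μ yy w y a b) := by
        refine Finset.sum_congr rfl fun κ'' _ => tsum_congr fun u => ?_
        rw [mul_neg, Finset.mul_sum, ← Finset.sum_neg_distrib]
    _ = ∑ κ'', ∑ μ, ∑' u, -(A κ'' u * ∑' yy, lamCoeffOf (KInv (N := N') (d := d)) N' μ yy κ'' u * Q2 μ yy w y a b) := by
        refine Finset.sum_congr rfl fun κ'' _ => ?_
        exact Summable.tsum_finsetSum fun μ _ => (hT κ'' μ).neg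
    _ = ∑ κ'', ∑ μ, -∑' yy, (∑' u, A κ'' u * lamCoeffOf (KInv (N := N') (d := d)) N' μ yy κ'' u) * Q2 μ yy w y a b := by
        refine Finset.sum_congr rfl fun κ'' _ => Finset.sum_congr rfl fun μ _ => ?_
        rw [tsum_neg, tsum_mul_tsum_leg_comm (A κ'') (hA κ'') μ κ'' (fun yy => Q2 μ yy w y a b) fun yy => hQ μ yy w y a b]
    _ = ∑ μ, ∑ κ'', -∑' yy, (∑' u, A κ'' u * lamCoeffOf (KInv (N := N') (d := d)) N' μ yy κ'' u) * Q2 μ yy w y a b :=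
        Finset.sum_comm
    _ = ∑ μ, -∑' yy, ∑ κ'', (∑' u, A κ'' u * lamCoeffOf (KInv (N := N') (d := d)) N' μ yy κ'' u) * Q2 μ yy w y a b := by
        refine Finset.sum_congr rfl fun μ _ => ?_
        rw [Finset.sum_neg_distrib, Summable.tsum_finsetSum fun κ'' _ => hY μ κ'']
    _ = ∑ μ, ∑' yy, (∑' bb, ∑ κ, wΦ (N := N') κ μ (bb - yy) * contourSum N' A κ bb) * Q2 μ yy w y a b := by
        refine Finset.sum_congr rfl fun μ _ => ?_
        rw [← tsum_neg]
        refine tsum_congr fun yy => ?_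
        rw [← Finset.sum_mul, bracket_eq_neg_pairing' A hA μ yy, neg_mul, neg_neg]

/-- [folklore] **TOP LEVEL (`N′ = N`): THE Λ VERTEX INSERTION IS A COARSE SUPERPOSITION OF THE MULTIPLIER KERNEL** —
`Σ_{κ″} Σ'_u wH_N κ″ κ′ (u − N•u′) · (SLam N (lamCoeffOf (KInv N) N) Q2 κ″ u) w y a b = Σ_μ Σ'_yy wΦ_N κ′ μ (u′ − yy) · Q2 μ yy w y a b`. -/
theorem vertex_SLam_top (Q2 : Fin (d + 1) → Site (d + 1) → ExpKernelCalculus.MKer (d + 1) (Fib d)) {B : ℝ}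
    (hQ : ∀ μ yy w y a b, |Q2 μ yy w y a b| ≤ B) (κ' : Fin (d + 1)) (u' w y : Site (d + 1)) (a b : Fib d) :
    ∑ κ'', ∑' u, wH (N := N) κ'' κ' (u - (N : ℤ) • u') * SLam N (lamCoeffOf (KInv (N := N) (d := d)) N) Q2 κ'' u w y a b =
      ∑ μ, ∑' yy, wΦ (N := N) κ' μ (u' - yy) * Q2 μ yy w y a b := by
  have h := vertex_SLam_eq (N' := N) (fun κ'' u => wH (N := N) κ'' κ' (u - (N : ℤ) • u')) (fun κ'' => summable_wH_col κ'' κ' u')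
    Q2 hQ w y a b
  simpa only [pairing_top] using h

/-- [folklore] an1's one-step constraint Hessians, lifted to the fine field legs, are entrywise bounded by `2·ℓ(Lc)²` (uniformly in the coarse bond,
the blocking `M` and the arguments): `biLoc_hessFF` at rate `0` and `DecLiftAdjoint.abs_avgLift_le`. -/
theorem abs_avgLift_hessFF_le {Lc : ℕ} (M : ℕ) [NeZero M] (hLc : 1 ≤ Lc) (μ : Fin (d + 1)) (yy w y : Site (d + 1)) (a b : Fib d) :
    |avgLift M (hessFF (d := d) Lc μ yy) w y a b| ≤ 2 * (ell (d + 1) Lc : ℝ) ^ 2 := by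
  refine abs_avgLift_le M (fun x w' a' b' => ?_) w y a b
  simpa using biLoc_hessFF (d := d) hLc μ yy le_rfl x w' a' b'

/-- [folklore] **TOP Λ ROW: THE VERTEX INSERTION OF THE LAGRANGE INCREMENT** (every `M`, `Lc ≥ 1`, `N ≥ 1`; for `e3LamTop_unit_split`: `M = Lc^ℓ`,
`N = Lc^{ℓ+1}`) — `Σ_{κ″} Σ'_u wH_N κ″ κ′ (u − N•u′) · lagrInc d Lc M N κ″ u w y a b = Σ_μ Σ'_yy wΦ_N κ′ μ (u′ − yy) · avgLift M (hessFF Lc μ yy) w y a b`: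
the fine vertex sum, the multiplier response and the gauge term are GONE; what remains is the level-`N` multiplier kernel (K-slot mm currency, (N3))
against an1's lifted constraint Hessians. -/
theorem vertex_lagrInc_top {Lc : ℕ} (M : ℕ) [NeZero M] (hLc : 1 ≤ Lc) (κ' : Fin (d + 1)) (u' w y : Site (d + 1)) (a b : Fib d) :
    ∑ κ'', ∑' u, wH (N := N) κ'' κ' (u - (N : ℤ) • u') * lagrInc d Lc M N κ'' u w y a b =
      ∑ μ, ∑' yy, wΦ (N := N) κ' μ (u' - yy) * avgLift M (hessFF (d := d) Lc μ yy) w y a b :=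
  vertex_SLam_top (N := N) (fun μ yy => avgLift M (hessFF (d := d) Lc μ yy))
    (fun μ yy w y a b => abs_avgLift_hessFF_le M hLc μ yy w y a b) κ' u' w y a b

end Vertex

end Summit.QuantumFields.BalabanUV.Beta.GAN24.TaylorLamBracket

end
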